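import Literature.Geometry.Lorentzian.HypersurfaceShadowOpenAbove
import HarnessLib

/-!
# The shadow domain of an acausal hypersurface: definition as a union, openness, connectedness,
# and the compact-shadow points it contains (domain of dependence, shadow form)

Pure causality, in the setting of `HypersurfaceShadowOpenAbove`: `(M, g, τ)` with sequentially
closed `≤`, compact `J±(C) ∩ J∓(y)` for compact `C` and the causality condition; `ι : X → M` an
injective continuous map (an embedding, where needed) from a locally compact Hausdorff space with
ACAUSAL image `S = ι(X)` having the localised trichotomy property (e.g. a smooth spacelike
hypersurface). The **shadow domain** of `S` is the union

  `V = S ∪ V⁺ ∪ V⁻`,  `V⁺ = ⋃ {I⁻(x) ∩ I⁺(S) : ι⁻¹ J⁻(x) compact}`,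
  `V⁻ = ⋃ {I⁺(x) ∩ I⁻(S) : ι⁻¹ J⁺(x) compact}`

(written out; the sets enter the statements through defining equations `hVp`, `hVm`, no
definition is introduced). It is the region that the shadow form of the Choquet-Bruhat–Geroch
gluing needs (`HypersurfaceCorrespondingBoundaryShadow`): it plays the part of the Cauchy
development `D(S)` (O'Neill 1983, Def. 14.35), but its openness is immediate from its form and
from `exists_ll_compactShadow` instead of resting on limit curves (O'Neill 1983, Lemma 14.43).

* `isOpen_shadowDomain` — `V` is open (`V±` are unions of open sets; a point `ι u` of `S` has
  compact-shadow points `x⁻ ≪ ι u ≪ x⁺` on both sides, and its trichotomy neighbourhood within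
  `I⁻(x⁺) ∩ I⁺(x⁻)` lies in `V`);
* `mem_shadowDomain_of_preimage_subset` / `mem_shadowDomain_of_shadow_subset` — **(hDsh⁺)**:
  every `y ∈ I⁺(S)` whose shadow (`ι⁻¹ J⁻(y)`, resp. `I⁻(y) ∩ S` inside a compact subset of `S`)
  is compact lies in `V` (`exists_ll_compactShadow` at `y`, and push-up along the hypersurface
  for the chronological form); time duals;
* `isConnected_shadowDomain` — `V` is connected when `X` is (every point of `V±` is joined to `S`
  by a timelike arc inside `V`).

The Cauchy property of `S` in `V` is proved in `HypersurfaceShadowDomainCauchy`.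
Everything is proved; no definitions, no named facts (D-0026).

## References

* B. O'Neill, *Semi-Riemannian geometry with applications to relativity*, Academic Press 1983,
  Ch. 14, Def. 14.35, Thm. 14.38, Lemma 14.43 (pp. 419–426). [ONeillSemiRiemannian1983]
* S. W. Hawking, G. F. R. Ellis, *The large scale structure of space-time*, CUP 1973, §6.5–6.6,
  Prop. 6.6.3, 6.6.6. [HawkingEllis1973CUP]
-/

noncomputable section

open Set Filter Function TopologicalSpace Topology
open scoped Manifold ContDiff Topology

namespace Literature.Geometry.Lorentzian

namespace LorentzianMetric

variable {E : Type*} [NormedAddCommGroup E] [NormedSpace ℝ E] {H : Type*} [TopologicalSpace H]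
  {I : ModelWithCorners ℝ E H} {n : ℕ∞ω} {M : Type*} [TopologicalSpace M] [ChartedSpace H M]
  [IsManifold I ∞ M] [T2Space M] [SecondCountableTopology M] [BoundarylessManifold I M]
  [FiniteDimensional ℝ E] {g : LorentzianMetric I n M} {τ : TimeOrientation g}
  {X' : Type*} [TopologicalSpace X'] {ι : X' → M}

/-! ### The shadow domain is open -/

/-- **The shadow domain `V = S ∪ V⁺ ∪ V⁻` of an acausal hypersurface is open.** `V⁺` and `V⁻`
are unions of the open sets `I⁻(x) ∩ I⁺(S)`, `I⁺(x) ∩ I⁻(S)`; a point `ι u ∈ S` has compact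
causal shadows `{u}` in both directions (acausality), so `exists_ll_compactShadow` and its dual
give compact-shadow points `x⁻ ≪ ι u ≪ x⁺`, and the trichotomy neighbourhood of `ι u` cut down
to `I⁻(x⁺) ∩ I⁺(x⁻)` lies in `V`. [cite: ONeillSemiRiemannian1983, Ch. 14, Lemma 14.43 (pp. 425–426)] -/
theorem isOpen_shadowDomain [LocallyCompactSpace X'] (hn : 2 ≤ n)
    (hcwb : g.IsCausallyWellBehaved τ) (hιc : Continuous ι) (hιi : Injective ι)
    (hac : ∀ p ∈ range ι, ∀ q ∈ range ι, q ∈ g.causalFuture τ {p} → q = p)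
    (hLT : ∀ (u : X') (O : Set X'), IsOpen O → u ∈ O → ∃ B : Set M, IsOpen B ∧ ι u ∈ B ∧
      B ⊆ ι '' O ∪ g.chronologicalFuture τ (ι '' O) ∪ g.chronologicalPast τ (ι '' O))
    (hrel : ∀ {xs ys : ℕ → M} {x y : M}, Tendsto xs atTop (𝓝 x) → Tendsto ys atTop (𝓝 y) →
      (∀ j, ys j ∈ g.causalFuture τ {xs j}) → y ∈ g.causalFuture τ {x})
    (hKC : ∀ C : Set M, IsCompact C → ∀ y : M,
      IsCompact (g.causalFuture τ C ∩ g.causalPast τ {y}))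
    (hKC' : ∀ C : Set M, IsCompact C → ∀ y : M,
      IsCompact (g.causalPast τ C ∩ g.causalFuture τ {y}))
    {Vp Vm : Set M}
    (hVp : Vp = {y | y ∈ g.chronologicalFuture τ (range ι) ∧ ∃ x ∈ g.chronologicalFuture τ {y},
      ∃ K : Set X', IsCompact K ∧ ι ⁻¹' g.causalPast τ {x} ⊆ K})
    (hVm : Vm = {y | y ∈ g.chronologicalPast τ (range ι) ∧ ∃ x ∈ g.chronologicalPast τ {y},
      ∃ K : Set X', IsCompact K ∧ ι ⁻¹' g.causalFuture τ {x} ⊆ K}) :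
    IsOpen (range ι ∪ Vp ∪ Vm) := by
  subst hVp hVm
  -- the single-point shadows of points of `S`
  have hshS : ∀ u : X', ι ⁻¹' g.causalPast τ {ι u} ⊆ {u} := fun u v hv ↦
    hιi (hac (ι v) ⟨v, rfl⟩ (ι u) ⟨u, rfl⟩ (mem_causalPast_singleton_iff.1 hv)).symm
  have hshS' : ∀ u : X', ι ⁻¹' g.causalFuture τ {ι u} ⊆ {u} := fun u v hv ↦
    hιi (hac (ι u) ⟨u, rfl⟩ (ι v) ⟨v, rfl⟩ hv)
  rw [isOpen_iff_forall_mem_open]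
  rintro y ((⟨u, rfl⟩ | hyp) | hym)
  · -- a point of `S`
    obtain ⟨xp, hxp, Kp, hKp, hshp⟩ := exists_ll_compactShadow hn hcwb hιc hιi hac hLT hrel hKC
      (Or.inl ⟨u, rfl⟩) isCompact_singleton (hshS u)
    obtain ⟨xm, hxm, Km, hKm, hshm⟩ := exists_gg_compactShadow hn hcwb hιc hιi hac hLT hrel hKC'
      (Or.inl ⟨u, rfl⟩) isCompact_singleton (hshS' u)
    obtain ⟨B, hBo, huB, hBO⟩ := hLT u univ isOpen_univ (mem_univ u)
    rw [image_univ] at hBO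
    refine ⟨B ∩ g.chronologicalPast τ {xp} ∩ g.chronologicalFuture τ {xm}, ?_, ?_, ?_⟩
    · rintro z ⟨⟨hzB, hzp⟩, hzm⟩
      rcases hBO hzB with (hS | hfut) | hpast
      · exact Or.inl (Or.inl hS)
      · exact Or.inl (Or.inr ⟨hfut, xp, mem_chronologicalFuture_of_mem_chronologicalPast hzp,
          Kp, hKp, hshp⟩)
      · exact Or.inr ⟨hpast, xm, mem_chronologicalPast_of_mem_chronologicalFuture hzm,
          Km, hKm, hshm⟩
    · exact (hBo.inter (isOpen_chronologicalPast_of_boundaryless g τ _)).inter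
        (isOpen_chronologicalFuture_of_boundaryless g τ _)
    · exact ⟨⟨huB, mem_chronologicalPast_of_mem_chronologicalFuture hxp⟩,
        mem_chronologicalFuture_of_mem_chronologicalPast hxm⟩
  · -- a point of `V⁺`
    obtain ⟨hyI, x, hxy, K, hK, hsh⟩ := hyp
    refine ⟨g.chronologicalFuture τ (range ι) ∩ g.chronologicalPast τ {x}, ?_,
      (isOpen_chronologicalFuture_of_boundaryless g τ _).inter
        (isOpen_chronologicalPast_of_boundaryless g τ _),
      ⟨hyI, mem_chronologicalPast_of_mem_chronologicalFuture hxy⟩⟩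
    rintro z ⟨hzI, hzx⟩
    exact Or.inl (Or.inr ⟨hzI, x, mem_chronologicalFuture_of_mem_chronologicalPast hzx, K, hK, hsh⟩)
  · -- a point of `V⁻`
    obtain ⟨hyI, x, hxy, K, hK, hsh⟩ := hym
    refine ⟨g.chronologicalPast τ (range ι) ∩ g.chronologicalFuture τ {x}, ?_,
      (isOpen_chronologicalPast_of_boundaryless g τ _).inter
        (isOpen_chronologicalFuture_of_boundaryless g τ _),
      ⟨hyI, mem_chronologicalFuture_of_mem_chronologicalPast hxy⟩⟩
    rintro z ⟨hzI, hzx⟩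
    exact Or.inr ⟨hzI, x, mem_chronologicalPast_of_mem_chronologicalFuture hzx, K, hK, hsh⟩

/-! ### Compact-shadow points lie in the shadow domain -/

/-- **(hDsh⁺), causal form**: a point of `I⁺(S)` with compact causal shadow `ι⁻¹ J⁻(y)` lies in
`V⁺` — it is chronologically below a compact-shadow point (`exists_ll_compactShadow`).
[cite: ONeillSemiRiemannian1983, Ch. 14, Lemma 14.43 (pp. 425–426)] -/
theorem mem_shadowDomain_of_preimage_subset [LocallyCompactSpace X'] (hn : 2 ≤ n)
    (hcwb : g.IsCausallyWellBehaved τ) (hιc : Continuous ι) (hιi : Injective ι)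
    (hac : ∀ p ∈ range ι, ∀ q ∈ range ι, q ∈ g.causalFuture τ {p} → q = p)
    (hLT : ∀ (u : X') (O : Set X'), IsOpen O → u ∈ O → ∃ B : Set M, IsOpen B ∧ ι u ∈ B ∧
      B ⊆ ι '' O ∪ g.chronologicalFuture τ (ι '' O) ∪ g.chronologicalPast τ (ι '' O))
    (hrel : ∀ {xs ys : ℕ → M} {x y : M}, Tendsto xs atTop (𝓝 x) → Tendsto ys atTop (𝓝 y) →
      (∀ j, ys j ∈ g.causalFuture τ {xs j}) → y ∈ g.causalFuture τ {x})
    (hKC : ∀ C : Set M, IsCompact C → ∀ y : M,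
      IsCompact (g.causalFuture τ C ∩ g.causalPast τ {y}))
    {Vp : Set M}
    (hVp : Vp = {y | y ∈ g.chronologicalFuture τ (range ι) ∧ ∃ x ∈ g.chronologicalFuture τ {y},
      ∃ K : Set X', IsCompact K ∧ ι ⁻¹' g.causalPast τ {x} ⊆ K})
    {y : M} (hy : y ∈ g.chronologicalFuture τ (range ι)) {K : Set X'} (hK : IsCompact K)
    (hsh : ι ⁻¹' g.causalPast τ {y} ⊆ K) : y ∈ Vp := by
  subst hVp
  obtain ⟨x, hxy, K', hK', hsh'⟩ :=
    exists_ll_compactShadow hn hcwb hιc hιi hac hLT hrel hKC (Or.inr hy) hK hsh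
  exact ⟨hy, x, hxy, K', hK', hsh'⟩

/-- **(hDsh⁺), chronological form** (the hypothesis of `false_of_corresponding_shadow`): a point
`y ∈ I⁺(S)` with `I⁻(y) ∩ S ⊆ C` for a compact `C ⊆ S` lies in `V⁺`, for an embedding `ι` of a
Hausdorff space: `ι⁻¹ C` is compact, and the causal shadow of `y` lies in it as well (push-up
along the hypersurface, `preimage_causalPast_subset_of_preimage_chronologicalPast_subset`).
[cite: ONeillSemiRiemannian1983, Ch. 14, Lemma 14.43 (pp. 425–426)] -/
theorem mem_shadowDomain_of_shadow_subset [LocallyCompactSpace X'] [T2Space X'] (hn : 2 ≤ n)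
    (hcwb : g.IsCausallyWellBehaved τ) (hιe : IsEmbedding ι)
    (hac : ∀ p ∈ range ι, ∀ q ∈ range ι, q ∈ g.causalFuture τ {p} → q = p)
    (hLT : ∀ (u : X') (O : Set X'), IsOpen O → u ∈ O → ∃ B : Set M, IsOpen B ∧ ι u ∈ B ∧
      B ⊆ ι '' O ∪ g.chronologicalFuture τ (ι '' O) ∪ g.chronologicalPast τ (ι '' O))
    (hrel : ∀ {xs ys : ℕ → M} {x y : M}, Tendsto xs atTop (𝓝 x) → Tendsto ys atTop (𝓝 y) →
      (∀ j, ys j ∈ g.causalFuture τ {xs j}) → y ∈ g.causalFuture τ {x})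
    (hKC : ∀ C : Set M, IsCompact C → ∀ y : M,
      IsCompact (g.causalFuture τ C ∩ g.causalPast τ {y}))
    {Vp : Set M}
    (hVp : Vp = {y | y ∈ g.chronologicalFuture τ (range ι) ∧ ∃ x ∈ g.chronologicalFuture τ {y},
      ∃ K : Set X', IsCompact K ∧ ι ⁻¹' g.causalPast τ {x} ⊆ K})
    {y : M} (hy : y ∈ g.chronologicalFuture τ (range ι)) {C : Set M} (hCS : C ⊆ range ι)
    (hC : IsCompact C) (hsh : g.chronologicalPast τ {y} ∩ range ι ⊆ C) : y ∈ Vp := by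
  -- `ι⁻¹ C` is compact and contains the chronological shadow, hence the causal shadow
  have hKc : IsCompact (ι ⁻¹' C) := by
    rw [hιe.isCompact_iff, image_preimage_eq_of_subset hCS]
    exact hC
  have hsh₁ : ι ⁻¹' g.chronologicalPast τ {y} ⊆ ι ⁻¹' C := fun u hu ↦ hsh ⟨hu, u, rfl⟩
  have hyS : y ∉ range ι := not_mem_range_of_mem_chronologicalFuture_range hcwb hac hy
  have hsh₂ : ι ⁻¹' g.causalPast τ {y} ⊆ ι ⁻¹' C :=
    preimage_causalPast_subset_of_preimage_chronologicalPast_subset hn hcwb hac hLT hyS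
      hKc.isClosed hsh₁
  exact mem_shadowDomain_of_preimage_subset hn hcwb hιe.continuous hιe.injective hac hLT hrel hKC
    hVp hy hKc hsh₂

/-- **(hDsh⁻), chronological form**: a point `y ∈ I⁻(S)` with `I⁺(y) ∩ S ⊆ C`, `C ⊆ S` compact,
lies in `V⁻` (the time dual). [cite: ONeillSemiRiemannian1983, Ch. 14, Lemma 14.43 (pp. 425–426)] -/
theorem mem_shadowDomain_of_shadow_subset' [LocallyCompactSpace X'] [T2Space X'] (hn : 2 ≤ n)
    (hcwb : g.IsCausallyWellBehaved τ) (hιe : IsEmbedding ι)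
    (hac : ∀ p ∈ range ι, ∀ q ∈ range ι, q ∈ g.causalFuture τ {p} → q = p)
    (hLT : ∀ (u : X') (O : Set X'), IsOpen O → u ∈ O → ∃ B : Set M, IsOpen B ∧ ι u ∈ B ∧
      B ⊆ ι '' O ∪ g.chronologicalFuture τ (ι '' O) ∪ g.chronologicalPast τ (ι '' O))
    (hrel : ∀ {xs ys : ℕ → M} {x y : M}, Tendsto xs atTop (𝓝 x) → Tendsto ys atTop (𝓝 y) →
      (∀ j, ys j ∈ g.causalFuture τ {xs j}) → y ∈ g.causalFuture τ {x})
    (hKC' : ∀ C : Set M, IsCompact C → ∀ y : M,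
      IsCompact (g.causalPast τ C ∩ g.causalFuture τ {y}))
    {Vm : Set M}
    (hVm : Vm = {y | y ∈ g.chronologicalPast τ (range ι) ∧ ∃ x ∈ g.chronologicalPast τ {y},
      ∃ K : Set X', IsCompact K ∧ ι ⁻¹' g.causalFuture τ {x} ⊆ K})
    {y : M} (hy : y ∈ g.chronologicalPast τ (range ι)) {C : Set M} (hCS : C ⊆ range ι)
    (hC : IsCompact C) (hsh : g.chronologicalFuture τ {y} ∩ range ι ⊆ C) : y ∈ Vm := by
  have hac' : ∀ p ∈ range ι, ∀ q ∈ range ι, q ∈ g.causalFuture τ.reverse {p} → q = p :=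
    fun p hp q hq h ↦ (hac q hq p hp (mem_causalPast_singleton_iff.1 h)).symm
  have hLT' : ∀ (u : X') (O : Set X'), IsOpen O → u ∈ O → ∃ B : Set M, IsOpen B ∧ ι u ∈ B ∧
      B ⊆ ι '' O ∪ g.chronologicalFuture τ.reverse (ι '' O) ∪
        g.chronologicalPast τ.reverse (ι '' O) := by
    intro u O hO huO
    obtain ⟨B, hB, huB, hBO⟩ := hLT u O hO huO
    refine ⟨B, hB, huB, fun z hz ↦ ?_⟩
    rw [chronologicalPast_reverse]
    rcases hBO hz with (h | h) | h
    · exact Or.inl (Or.inl h)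
    · exact Or.inr h
    · exact Or.inl (Or.inr h)
  have hrel' : ∀ {xs ys : ℕ → M} {x y : M}, Tendsto xs atTop (𝓝 x) → Tendsto ys atTop (𝓝 y) →
      (∀ j, ys j ∈ g.causalFuture τ.reverse {xs j}) → y ∈ g.causalFuture τ.reverse {x} := by
    intro xs ys x y hx hy' h
    show y ∈ g.causalPast τ {x}
    exact mem_causalPast_singleton_iff.2 (hrel hy' hx fun j ↦ mem_causalPast_singleton_iff.1 (h j))
  have hKC'' : ∀ C : Set M, IsCompact C → ∀ y : M,
      IsCompact (g.causalFuture τ.reverse C ∩ g.causalPast τ.reverse {y}) := by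
    intro C hC y
    rw [causalPast_reverse]
    exact hKC' C hC y
  have hVm' : Vm = {y | y ∈ g.chronologicalFuture τ.reverse (range ι) ∧
      ∃ x ∈ g.chronologicalFuture τ.reverse {y},
        ∃ K : Set X', IsCompact K ∧ ι ⁻¹' g.causalPast τ.reverse {x} ⊆ K} := by
    rw [hVm]
    simp only [causalPast_reverse]
    rfl
  have hsh' : g.chronologicalPast τ.reverse {y} ∩ range ι ⊆ C := by
    rw [chronologicalPast_reverse]; exact hsh
  exact mem_shadowDomain_of_shadow_subset (τ := τ.reverse) hn hcwb.reverse hιe hac' hLT' hrel'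
    hKC'' hVm' hy hCS hC hsh'

/-! ### The shadow domain is connected -/

omit [T2Space M] [SecondCountableTopology M] [BoundarylessManifold I M] [FiniteDimensional ℝ E] in
/-- **The shadow domain is connected** when `X` is: `S = ι(X)` is connected, and a point
`y ∈ V⁺`, `y ≪ x` with `x` of compact shadow, is joined to `S` by a timelike arc from some
`s₀ ∈ S`, all of whose later points are in `I⁺(S) ∩ I⁻(x) ⊆ V⁺`; dually for `V⁻`.
[cite: ONeillSemiRiemannian1983, Ch. 14, Def. 14.35 ff.] -/
theorem isConnected_shadowDomain [ConnectedSpace X'] (hn : 2 ≤ n) (hιc : Continuous ι)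
    {Vp Vm : Set M}
    (hVp : Vp = {y | y ∈ g.chronologicalFuture τ (range ι) ∧ ∃ x ∈ g.chronologicalFuture τ {y},
      ∃ K : Set X', IsCompact K ∧ ι ⁻¹' g.causalPast τ {x} ⊆ K})
    (hVm : Vm = {y | y ∈ g.chronologicalPast τ (range ι) ∧ ∃ x ∈ g.chronologicalPast τ {y},
      ∃ K : Set X', IsCompact K ∧ ι ⁻¹' g.causalFuture τ {x} ⊆ K}) :
    IsConnected (range ι ∪ Vp ∪ Vm) := by
  classical
  subst hVp hVm
  have hn1 : (1 : ℕ∞ω) ≤ n := le_trans one_le_two hn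
  obtain ⟨u₀⟩ : Nonempty X' := inferInstance
  have hSc : IsConnected (range ι) := isConnected_range hιc
  -- every point of `V` lies, together with `S`, in a connected subset of `V`
  set V : Set M := range ι ∪
    {y | y ∈ g.chronologicalFuture τ (range ι) ∧ ∃ x ∈ g.chronologicalFuture τ {y},
      ∃ K : Set X', IsCompact K ∧ ι ⁻¹' g.causalPast τ {x} ⊆ K} ∪
    {y | y ∈ g.chronologicalPast τ (range ι) ∧ ∃ x ∈ g.chronologicalPast τ {y},
      ∃ K : Set X', IsCompact K ∧ ι ⁻¹' g.causalFuture τ {x} ⊆ K} with hV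
  have key : ∀ y ∈ V, ∃ T : Set M, IsPreconnected T ∧ range ι ⊆ T ∧ y ∈ T ∧ T ⊆ V := by
    rintro y ((hyS | ⟨hyI, x, hxy, K, hK, hsh⟩) | ⟨hyI, x, hxy, K, hK, hsh⟩)
    · exact ⟨range ι, hSc.isPreconnected, Subset.rfl, hyS, subset_union_left.trans subset_union_left⟩
    · -- a timelike arc from `s₀ ∈ S` to `y`
      have h := hyI
      rw [chronologicalFuture_eq_biUnion] at h
      simp only [mem_iUnion, exists_prop] at h
      obtain ⟨s₀, hs₀, hys₀⟩ := h
      obtain ⟨z, hz, σ, a, b, hab, hσ, hσa, hσb⟩ := hys₀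
      rw [mem_singleton_iff] at hz
      rw [hz] at hσa
      have hTV : σ '' Icc a b ⊆ V := by
        rintro _ ⟨t, ht, rfl⟩
        rcases eq_or_lt_of_le ht.1 with heq | hat
        · rw [← heq, hσa]; exact Or.inl (Or.inl hs₀)
        have h1 : σ t ∈ g.chronologicalFuture τ (range ι) :=
          chronologicalFuture_mono (singleton_subset_iff.2 hs₀)
            ⟨σ a, hσa, σ, a, t, hat, hσ.mono (Icc_subset_Icc le_rfl ht.2), rfl, rfl⟩
        have h2 : x ∈ g.chronologicalFuture τ {σ t} := by
          rcases eq_or_lt_of_le ht.2 with heq | htb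
          · rw [heq, hσb]; exact hxy
          · have h3 : y ∈ g.chronologicalFuture τ {σ t} :=
              ⟨σ t, rfl, σ, t, b, htb, hσ.mono (Icc_subset_Icc ht.1 le_rfl), rfl, hσb⟩
            exact mem_chronologicalFuture_trans h3 hxy
        exact Or.inl (Or.inr ⟨h1, x, h2, K, hK, hsh⟩)
      refine ⟨range ι ∪ σ '' Icc a b, ?_, subset_union_left, Or.inr ⟨b, right_mem_Icc.2 hab.le, hσb⟩,
        union_subset (subset_union_left.trans subset_union_left) hTV⟩
      refine IsPreconnected.union s₀ hs₀ ⟨a, left_mem_Icc.2 hab.le, hσa⟩ hSc.isPreconnected ?_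
      exact (isPreconnected_Icc.image σ fun t ht ↦ (hσ t ht).1.continuousAt.continuousWithinAt)
    · -- the dual arc from `y` to `s₀ ∈ S`
      have h := hyI
      rw [chronologicalPast, chronologicalFuture_eq_biUnion] at h
      simp only [mem_iUnion, exists_prop] at h
      obtain ⟨s₀, hs₀, hys₀⟩ := h
      have hys₀' : s₀ ∈ g.chronologicalFuture τ {y} := mem_chronologicalFuture_of_mem_chronologicalPast hys₀
      obtain ⟨z, hz, σ, a, b, hab, hσ, hσa, hσb⟩ := hys₀'
      rw [mem_singleton_iff] at hz
      rw [hz] at hσa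
      have hxy' : y ∈ g.chronologicalFuture τ {x} := mem_chronologicalFuture_of_mem_chronologicalPast hxy
      have hTV : σ '' Icc a b ⊆ V := by
        rintro _ ⟨t, ht, rfl⟩
        rcases eq_or_lt_of_le ht.2 with heq | htb
        · rw [heq, hσb]; exact Or.inl (Or.inl hs₀)
        have h1 : σ t ∈ g.chronologicalPast τ (range ι) := by
          have h3 : σ b ∈ g.chronologicalFuture τ {σ t} :=
            ⟨σ t, rfl, σ, t, b, htb, hσ.mono (Icc_subset_Icc ht.1 le_rfl), rfl, rfl⟩
          rw [hσb] at h3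
          rw [chronologicalPast, chronologicalFuture_eq_biUnion]
          simp only [mem_iUnion, exists_prop]
          exact ⟨s₀, hs₀, mem_chronologicalPast_of_mem_chronologicalFuture h3⟩
        have h2 : x ∈ g.chronologicalPast τ {σ t} := by
          refine mem_chronologicalPast_of_mem_chronologicalFuture ?_
          rcases eq_or_lt_of_le ht.1 with heq | hat
          · rw [← heq, hσa]; exact hxy'
          · have h3 : σ t ∈ g.chronologicalFuture τ {y} :=
              ⟨σ a, hσa, σ, a, t, hat, hσ.mono (Icc_subset_Icc le_rfl ht.2), rfl, rfl⟩
            exact mem_chronologicalFuture_trans hxy' h3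
        exact Or.inr ⟨h1, x, h2, K, hK, hsh⟩
      refine ⟨range ι ∪ σ '' Icc a b, ?_, subset_union_left, Or.inr ⟨a, left_mem_Icc.2 hab.le, hσa⟩,
        union_subset (subset_union_left.trans subset_union_left) hTV⟩
      refine IsPreconnected.union s₀ hs₀ ⟨b, right_mem_Icc.2 hab.le, hσb⟩ hSc.isPreconnected ?_
      exact (isPreconnected_Icc.image σ fun t ht ↦ (hσ t ht).1.continuousAt.continuousWithinAt)
  -- assemble: `V` is the union of these connected sets, all containing `ι u₀`
  choose T hTc hTS hTy hTV using key
  have hVeq : V = ⋃₀ {A | ∃ (y : M) (hy : y ∈ V), A = T y hy} := by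
    apply Subset.antisymm
    · intro y hy
      exact ⟨T y hy, ⟨y, hy, rfl⟩, hTy y hy⟩
    · rintro z ⟨_, ⟨y, hy, rfl⟩, hz⟩
      exact hTV y hy hz
  refine ⟨⟨ι u₀, Or.inl (Or.inl ⟨u₀, rfl⟩)⟩, ?_⟩
  show IsPreconnected V
  rw [hVeq]
  refine isPreconnected_sUnion (ι u₀) _ ?_ ?_
  · rintro _ ⟨y, hy, rfl⟩
    exact hTS y hy ⟨u₀, rfl⟩
  · rintro _ ⟨y, hy, rfl⟩
    exact hTc y hy

end LorentzianMetric

end Literature.Geometry.Lorentzian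

end
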